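import Summits.AtomisticToContinuum.HydrodynamicLimit.Theorems.TwoClocksEquilibriumFastWindowLDReductionBounded
import Summits.AtomisticToContinuum.HydrodynamicLimit.Theorems.TwoClocksEquilibriumFastWindowLDStubTiltDuality
import Summits.AtomisticToContinuum.HydrodynamicLimit.Theses.TwoClocks

/-!
# Skeleton of the line `Sketch` for the crux `TwoClocks.EquilibriumFastWindowLD`
(stmt-AtomisticToContinuum-14440; lead prover-line-stmt-AtomisticToContinuum-14440-c4-0, continuing c3; skeleton rev 5.2)

Card `static-seed-doubling-rg` (ideator 2) with the free normal form of card `bounded-frozen-normal-form`.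
History: rev 2 (lead 14440-0) — six static stubs + S4' `stub_doublingGainBounded`; rev 3/4 (lead c1) — the
six static stubs LANDED (`stub_bookkeeping` p114467, `stub_oneSiteGauss` p114839, `stub_staticReduction`
p115071, `stub_dualFamily` p116778, `stub_truncation` p117861, `stub_holderSplit` p118138), the reductions
LANDED (`Theorems/TwoClocksEquilibriumFastWindowLDReductionBounded.lean`, p125773:
`boundedWindowLD_of_doublingGainBounded`, `EquilibriumFastWindowLD_of_boundedWindowLD`), one open stub
`stub_boundedWindowLD` = W = the crux restricted to the bounded class `𝒢(C')` (continuous,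
`|G(x,v)| ≤ C'(1+|v|²)`, compact `v`-support, `M_{1,u₀,θ₀}`-orthogonal at every `x` to `1, v_j, |v|²`)
with a class-uniform tilt range `β₁(C')`.

**Rev 5 (this lead): Gibbs–entropy duality normal form of W.** Write
`S^G_{N,τ}(z) := Σᵢ w⁻¹∫₀ʷ G((Φ_N.flow r z)ᵢ) dr`, `w = τ (N+1)^{-1/3}`, `G_N := localGibbsLaw σ a₀ u₀ θ₀ N Φ_N`
(constant profiles). W is split as `W ⟸ stub_tiltDuality (stub_perturbativeRelaxation)`:

* `stub_perturbativeRelaxation` (OPEN — the dynamical content, PERTURBATIVE ENTROPY FORM): at every small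
  reduced density, for every `C' ≥ 0` there are `β₁ > 0` and an entropy radius `s₀ > 0`, uniform over
  `𝒢(C')`, such that for every `G ∈ 𝒢(C')` and `ε > 0` there is a window `τ > 0` with, eventually in `N`,
  for EVERY probability law `Q ≪ G_N` of relative entropy `H(Q | G_N) ≤ s₀ (N+1)`:
  `β₁ · E_Q[S^G_{N,τ}] ≤ H(Q | G_N) + ε (N+1)`
  — time-averaged one-body fast means of small-entropy perturbations of the global Gibbs state are
  ENTROPY-LINEAR up to `o(N)`, after a kinetic window `τ(ε)`. (The large-entropy regime needs nothing:
  it is absorbed by the static sub-Gaussian bound inside the duality; `s₀` may be as small as one likes.)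
* `stub_tiltDuality` (LANDED p127451, lead c3 wave 1): `stub_perturbativeRelaxation → W`. For `0 < β ≤ β₁'`,
  `β₁' := min β₁ (min (t₀/2) (s₀/(2Kt₀+1)))` with `t₀, K` the class-uniform one-site constants of
  `stub_oneSiteGauss`, let `Z := ∫ e^{βS} dG_N` and `Q* := G_N.tilted (βS)`. If `Z ≤ 1` there is nothing to
  prove. Otherwise `H(Q*|G_N) = β E_{Q*}S − log Z < β E_{Q*}S` (Gibbs variational identity,
  `LedgerAssembly.klDiv_tilted_eq`), and the entropy inequality at tilt `t₀` against the static window bound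
  `∫ e^{t₀ S} dG_N ≤ e^{K t₀² (N+1)}` (`stub_staticReduction` + `stub_oneSiteGauss`) gives
  `E_{Q*}S ≤ (H(Q*|G_N) + K t₀²(N+1))/t₀`, whence `H(Q*|G_N) < 2βKt₀(N+1) ≤ s₀(N+1)`: the tilted law is in the
  perturbative class, so `β E_{Q*} S ≤ (β/β₁)(H + ε(N+1)) ≤ H + ε(N+1)` and `log Z ≤ ε(N+1)`. Negative `β`:
  apply the stub to `−G ∈ 𝒢(C')`.

`EquilibriumFastWindowLD_of` concludes the crux BY NAME through the landed normal-form step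
`EquilibriumFastWindowLD_of_boundedWindowLD`; `sorry` only inside `stub_*`.

**Rev 5.2 (lead c4): the stub IS the crux.** The converse directions are landed (all `--supports` this item):
`boundedWindowLD_of_EquilibriumFastWindowLD : crux → W` (`Theorems/…NormalFormEquivalence.lean`, p135446: automatic
uniformity of the tilt range by Baire category on the closed subspace of encoded admissible observables of
`𝕋³×ℝ³ →ᵇ ℝ` + window quasi-monotonicity; ingredients `…WindowExtension` p134349, `…BaireUniformity` p134424,
`…NormalFormClass` p135150, `…NormalFormClosure` p135342), whence
`perturbativeRelaxation_iff_EquilibriumFastWindowLD : (statement of stub_perturbativeRelaxation) ↔ crux` and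
`boundedWindowLD_iff_EquilibriumFastWindowLD : W ↔ crux` (`Theorems/…NormalFormIff.lean`, p135606). The composition
below is unchanged (imports kept minimal so that this skeleton elaborates independently of those files). Nothing
static remains anywhere in the line: proving the stub is proving the crux.
-/

noncomputable section

open MeasureTheory ProbabilityTheory Real Set Filter InformationTheory
open scoped ENNReal BigOperators

namespace Summit.AtomisticToContinuum.HydrodynamicLimit.Theorems.FastWindowRG

open Literature.Analysis.FluidPDE Literature.MathematicalPhysics.KineticTheory

/-! ## THE open stub: perturbative entropy-linear relaxation of time-averaged fast means -/

/-- **`stub_perturbativeRelaxation`** (OPEN; the crux's dynamical content in Gibbs–entropy duality normal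
form). There is a universal `σ₀ > 0` such that at every reduced density `0 < σ < σ₀`, for all constant
profiles, every family of hard-sphere flows and every `C' ≥ 0`, there are a rate `β₁ > 0` and an entropy
radius `s₀ > 0`, UNIFORM over the class `𝒢(C')`, such that for every `G ∈ 𝒢(C')` and every `ε > 0` there is
a window `τ > 0` with, for all large `N` and EVERY probability law `Q ≪ G_N` with
`klDiv Q G_N ≤ s₀ (N+1)`:
`β₁ ∫ Σᵢ w⁻¹∫₀ʷ G((Φ_N.flow r z)ᵢ) dr dQ(z) ≤ (klDiv Q G_N).toReal + ε (N+1)`, `w = τ (N+1)^{-1/3}`. -/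
theorem stub_perturbativeRelaxation :
    ∃ σ₀ : ℝ, 0 < σ₀ ∧ ∀ (a₀ θ₀ : ℝ) (u₀ : V3), 0 < a₀ → 0 < θ₀ → ∀ σ : ℝ, 0 < σ → σ < σ₀ →
      ∀ Φ : (N : ℕ) → HardSphereFlow (Torus.geometry (Fin 3)) (hsDiameter σ N) (N + 1),
      ∀ C' : ℝ, 0 ≤ C' → ∃ β₁ : ℝ, 0 < β₁ ∧ ∃ s₀ : ℝ, 0 < s₀ ∧
      ∀ G : T3 × V3 → ℝ, Continuous G → (∀ y, |G y| ≤ C' * (1 + ‖y.2‖ ^ 2)) →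
      (∃ R : ℝ, ∀ y : T3 × V3, R ≤ ‖y.2‖ → G y = 0) →
      (∀ x, ∫ v, G (x, v) * localMaxwellian 1 θ₀ u₀ v = 0) →
      (∀ x (j : Fin 3), ∫ v, G (x, v) * v j * localMaxwellian 1 θ₀ u₀ v = 0) →
      (∀ x, ∫ v, G (x, v) * ‖v‖ ^ 2 * localMaxwellian 1 θ₀ u₀ v = 0) →
      ∀ ε : ℝ, 0 < ε → ∃ τ : ℝ, 0 < τ ∧ ∃ N₀ : ℕ, ∀ N : ℕ, N₀ ≤ N →
        ∀ Q : Measure (Config (N + 1) (Fin 3) T3), IsProbabilityMeasure Q →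
          Q ≪ localGibbsLaw σ (fun _ => a₀) (fun _ => u₀) (fun _ => θ₀) N (Φ N) →
          klDiv Q (localGibbsLaw σ (fun _ => a₀) (fun _ => u₀) (fun _ => θ₀) N (Φ N)) ≤
            ENNReal.ofReal (s₀ * ((N : ℝ) + 1)) →
          β₁ * ∫ z, (∑ i : Fin (N + 1), (τ * ((N : ℝ) + 1) ^ (-(1 / 3 : ℝ)))⁻¹ *
              ∫ r in (0 : ℝ)..(τ * ((N : ℝ) + 1) ^ (-(1 / 3 : ℝ))), G (((Φ N).flow r z) i)) ∂Q ≤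
            (klDiv Q (localGibbsLaw σ (fun _ => a₀) (fun _ => u₀) (fun _ => θ₀) N (Φ N))).toReal +
              ε * ((N : ℝ) + 1) := by
  sorry

/-! ## The duality stub: LANDED (p127451)

`stub_tiltDuality : stub_perturbativeRelaxation-statement → W` is the theorem
`FastWindowRG.stub_tiltDuality` of `Theorems/TwoClocksEquilibriumFastWindowLDStubTiltDuality.lean`
(lead c3 wave 1, p127451; Gibbs variational identity at the tilt + entropy self-bound of the tilted
law from `stub_staticReduction`/`stub_oneSiteGauss`). It is imported, not restated. -/

example := @stub_tiltDuality

/-! ## Composition -/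

/-- **The composition of the line** (skeleton rev 5): the stubs ⟹ the crux, by name, through the landed
normal-form step `EquilibriumFastWindowLD_of_boundedWindowLD` (bounded class ⟹ every fast `F` of quadratic
growth). -/
theorem EquilibriumFastWindowLD_of :
    Summit.AtomisticToContinuum.HydrodynamicLimit.Theses.TwoClocks.EquilibriumFastWindowLD :=
  EquilibriumFastWindowLD_of_boundedWindowLD (stub_tiltDuality stub_perturbativeRelaxation)

end Summit.AtomisticToContinuum.HydrodynamicLimit.Theorems.FastWindowRG

end
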